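/-
Copyright (c) 2026 the pub-hodgecm-mathlib formalisation cell (harness21).  Prover seat hodgecm-mathlib-LH4-p11 (g11), req620 Track A «(D-RAM) FOUR-FRAME» squad
(STAGE-1b, row (2) of the piece `f_{T₊}`, the (β₂) road (R-36), the K6 road; K6 desk LH4-p16 (g3) WORD #16 (P2) «THE INSIDE DIGIT SYSTEM IS COVERED BY THE INSIDE CELLS
OF THE TWO LITERALS» — ★ HEAD₃ `coreWindow_of_cellValues_sphere`'s letters `hcov`, `hSPH`, `hHA` in the INSIDE chart), 2026-09-05.
-/
import Summits.HodgeConjecture.HodgeConjecture.Theorems.F0P3cDyRamRowCellDigitShellDictionary   -- ★ p864361 (LH7-p08 (g3), K6-(d)): `sphereClause_iff_max_eq`, `eq_of_sphereClause_of_sphereClause`, `exists_sphereClause_of_oneChart`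
import Summits.HodgeConjecture.HodgeConjecture.Theorems.F0P3cDyRamRowCellDigitClassSplit         -- ★ p864480 (LH7-p08 (g3), K6-(d′)): `classClause_or`, `classClause_iff_not_classClause`, `not_classClause'_of_far`
import HarnessLib

/-!
# Crux `H413`, line LH4 «(D-RAM) FOUR-FRAME» — STAGE-1b, row (2), the (β₂) road (R-36), K6-(e) assembly: «THE INSIDE DIGIT SYSTEM IS COVERED» — in the INSIDE chart
# (`|ξ₀| = exp 2(N − 1)`) every digit of the ONE digit system lies on the sphere of exactly one inside cell `i < N`, is of exactly one of the two literals' classes, and the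
# anisotropic class occurs only below the A-window cut `i < d`: the three structural letters `hcov`, `hSPH`, `hHA` of ★ HEAD₃ `coreWindow_of_cellValues_sphere`

Cell `hodgecm-mathlib` (D-0151), FLOOR 0, crux item H413 = `stmt-HodgeConjecture-24833`, route of record `HCCMUnconditional`; squad F0∕P3c∕LH4; lane
`--supports stmt-HodgeConjecture-24833 --as helper` (count-neutral; pays NO tier-0 row).  THEOREMS ONLY (no `def`, no instance, no notation, no `sorry`, default heartbeats);
★-only imports; states NO law; (β₂) stays a HYPOTHESIS.  Two-field letters as in ★ p864480 ∕ ★ p864361 (`jE : E → M`, `Fix ρ = jE(E)`, `Θ∘jE = jE∘σ`, `|jE a| = |a|`; `ρ` an isometric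
involution commuting with `Θ`; the wild datum `IsRamifiedQuadraticDatum σ ϖ d tE` on the complete `E` with finite residue field; lane B `|α − ρα| = 1`).

WHAT (K6 desk LH4-p16 (g3) WORD #16 (P2)).  The K6-(e) spine ★ HEAD₃ `…CoreOfPerCellLaws.coreWindow_of_cellValues_sphere` takes, besides the solved cell values, three STRUCTURAL letters
on the labelled digit families `S′_t i ⊆ Rd.filter (LIT t i)`: `hSPH` (a digit lies on at most one cell sphere), `hHA` (the two classes are disjoint), `hcov` (every digit of `B` is a
labelled digit of some listed cell of its literal).  In the INSIDE chart of ★-soon `…RowInsideChartLetters` (`κ₀ + ρκ₀ = 1`, `|κ₀| = 1`, `ρξ₀ = −ξ₀`, `|ξ₀| = exp 2(N − 1)`, `1 ≤ N`)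
with F1b ★ p864627's literal predicate
  `LIT_t i V₀ :≡ Valued.v (κ₀ + jE V₀·ξ₀) · Valued.v (jE ϖ^(b+2i)·(α − ρα)) = Valued.v (jE ϖ)^b ∧ ∃ e, ρe = e ∧ eΘe = (κ₀ + jE V₀·ξ₀)·ρ(κ₀ + jE V₀·ξ₀) ∕ (h_t·ρh_t)`
(`h_H = h` the hyperbolic, `h_A = h′` the anisotropic frame scalar) THIS FILE gives the digit-level facts behind them:
* §1 HEAD-sph `sphereIndex_unique` — `SPH i V ∧ SPH i′ V ⇒ i = i′` (★ `eq_of_sphereClause_of_sphereClause`, `b + 2i = b + 2i′`).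
* §2 HEAD-cls `classH_not_classA` — `CLASS_h V → ¬ CLASS_{h′} V` for a `σ`-fixed digit (★ `classClause_iff_not_classClause`).
* §3 `sphereIndex_lt_of_classA` — an A-class digit on sphere `i` has `i < d` (for `d ≤ i` the sphere is FAR, `|V₀|·|ξ₀| = exp 2i ≥ exp(2d − 1)`, ★ `not_classClause'_of_far`).
* §4 HEAD-cov `insideDigit_cover` ∕ `insideDigit_cover_filter` — every `σ`-fixed integral digit `V ∈ Rd` satisfies `LIT_H i V` for some `i < N` or `LIT_A i V` for some `i < min N d`
  (★ `exists_sphereClause_of_oneChart` at `N − 1` + ★ `classClause_or` + §3); Finset form `V ∈ Rd.filter (LIT_t i)` as in WORD #16.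
WHAT IS NOT CLAIMED: the labelled sub-families (`NX`), the solved values, any count or census identity.
HONEST LABEL.  Count-neutral valuation ∕ class bookkeeping; nothing printed is asserted; no census law is stated; `HC_CM` is proved only modulo the 7 printed citations (2 remaining named
inputs: hLiu418 = `stmt-HodgeConjecture-24832`, h413 = `stmt-HodgeConjecture-24833`) until rung 0 closes.
## References
* [Serre1979] J.-P. Serre, *Local Fields*, GTM 67 (1979): Ch. II §1 (ultrametric inequality), Ch. V §3 Prop. 5, Cor. 2–3 pp. 84–86 (norm index two).
* [Jacobowitz1962] R. Jacobowitz, *Hermitian forms over local fields*, Amer. J. Math. 84 (1962): §3 (the discriminant class).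
* [Flicker1998UnitaryFL] Y. Z. Flicker, *Elementary proof of the fundamental lemma for a unitary group*, Canad. J. Math. 50 (1998): Prop. 7 p. 84 (type RamK census by classes and shells).
* [Kottwitz1986BaseChangeUnits] R. E. Kottwitz, *Base change for unit elements of Hecke algebras*, Compositio Math. 60 (1986): §1 pp. 240–241 (fixed-lattice counts as orbital integrals).
-/

set_option autoImplicit false

noncomputable section

namespace Summit.HodgeConjecture.HodgeConjecture.Cruxes.H413.F0P3cDyRamInsideDigitCover

open scoped Valued WithZero Matrix MatrixGroups Classical
open WithZero Finset
open Literature.NumberTheory.Automorphic Literature.NumberTheory.Automorphic.UnitaryGroup Literature.NumberTheory.Automorphic.UnitaryLatticeTree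
open Literature.NumberTheory.Automorphic.UnitaryThreeFourFrame (IsRamifiedQuadraticDatum)
open Summit.HodgeConjecture.HodgeConjecture.Cruxes.H413.F0P3cDyRamRowCellDigitShellDictionary (sphereClause_iff_max_eq eq_of_sphereClause_of_sphereClause exists_sphereClause_of_oneChart)
open Summit.HodgeConjecture.HodgeConjecture.Cruxes.H413.F0P3cDyRamRowCellDigitClassSplit (classClause_or classClause_iff_not_classClause not_classClause'_of_far)

variable {E M : Type} [Field E] [Valued E ℤᵐ⁰] [Field M] [Valued M ℤᵐ⁰] {ρ Θ : M →+* M} {α : M}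

/-! ## §1 HEAD-sph — a digit lies on the sphere of at most one cell -/

omit [Valued E ℤᵐ⁰] in
/-- **HEAD-sph — THE SPHERE INDEX OF A DIGIT IS UNIQUE.**  `|jE a| = |a|`, `|ϖ| = exp(−1)`, `|α − ρα| = 1` (lane B): if the digit point `κ` satisfies the sphere clauses of the cells
`(b + 2i, b)` and `(b + 2i′, b)` then `i = i′` (★ `eq_of_sphereClause_of_sphereClause`).  (= ★ HEAD₃'s `hSPH` at `SPH i V := …(b + 2i)…`.) [cite: Serre1979, Ch. II §1] -/
theorem sphereIndex_unique [Valued E ℤᵐ⁰] (jE : E →+* M) (hjiso : ∀ a, Valued.v (jE a) = Valued.v a) {ϖ : E} (hϖ : Valued.v ϖ = exp (-1 : ℤ))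
    (hU : Valued.v (α - ρ α) = 1) {κ : M} {b i i' : ℕ}
    (hi : Valued.v κ * Valued.v (jE ϖ ^ (b + 2 * i) * (α - ρ α)) = Valued.v (jE ϖ) ^ b)
    (hi' : Valued.v κ * Valued.v (jE ϖ ^ (b + 2 * i') * (α - ρ α)) = Valued.v (jE ϖ) ^ b) : i = i' := by
  have h := eq_of_sphereClause_of_sphereClause (ρ := ρ) jE hjiso hϖ hU hi hi'
  omega

/-! ## §2 HEAD-cls — the two literals' classes are disjoint -/

omit [Valued M ℤᵐ⁰] in
/-- **HEAD-cls — THE HYPERBOLIC AND THE ANISOTROPIC CLASS ARE DISJOINT** on every point `κ₀ + jE V₀·ξ₀` of the line (CORE frame of ★ `classClause_iff_not_classClause`; `σV₀ = V₀`):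
`CLASS_h(V₀) → ¬ CLASS_{h′}(V₀)` (= ★ HEAD₃'s `hHA`). [cite: Jacobowitz1962, §3] [cite: Serre1979, Ch. V §3 Prop. 5, Cor. 2–3 pp. 84–86] -/
theorem classH_not_classA [CompleteSpace E] [Finite 𝓀[E]] {σ : E →+* E} {ϖ : E} {d tE : ℕ} (hD : IsRamifiedQuadraticDatum σ ϖ d tE)
    (jE : E →+* M) (hjfix : ∀ z, ρ z = z ↔ ∃ c, jE c = z) (hΘj : ∀ c, Θ (jE c) = jE (σ c))
    (hρρ : ∀ x, ρ (ρ x) = x) (hΘρ : ∀ x, Θ (ρ x) = ρ (Θ x)) (P₁ : GL (Fin 3) E) (dg : Fin 2 → E) (η : E)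
    (hA : formCongr σ P₁ ((StdForm.antidiagonal 3).over E) =
      (!![(Matrix.diagonal dg) 0 0, 0, (Matrix.diagonal dg) 0 1; 0, η, 0; (Matrix.diagonal dg) 1 0, 0, (Matrix.diagonal dg) 1 1] : Matrix (Fin 3) (Fin 3) E))
    (hηN : ¬ ∃ t : E, t * σ t = η)
    (φ : (Fin 2 → E) →+ M) {h : M} (hform : ∀ x y, jE (pairing σ ((StdForm.antidiagonal 2).over E) x y) = h * Θ (φ x) * φ y + ρ (h * Θ (φ x) * φ y))
    (hΘh : Θ h = h) (hh : h ≠ 0)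
    (φ' : (Fin 2 → E) →+ M) {h' : M} (hform' : ∀ x y, jE (pairing σ (Matrix.diagonal dg) x y) = h' * Θ (φ' x) * φ' y + ρ (h' * Θ (φ' x) * φ' y))
    (hΘh' : Θ h' = h') (hh' : h' ≠ 0)
    {κ₀ ξ₀ : M} (hκ₀ : κ₀ + ρ κ₀ = 1) (hΘκ₀ : Θ κ₀ = κ₀) (hξ : ρ ξ₀ = -ξ₀) (hΘξ : Θ ξ₀ = ξ₀) {V₀ : E} (hσV₀ : σ V₀ = V₀)
    (hH : ∃ e : M, ρ e = e ∧ e * Θ e = (κ₀ + jE V₀ * ξ₀) * ρ (κ₀ + jE V₀ * ξ₀) / (h * ρ h)) :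
    ¬ ∃ e : M, ρ e = e ∧ e * Θ e = (κ₀ + jE V₀ * ξ₀) * ρ (κ₀ + jE V₀ * ξ₀) / (h' * ρ h') := fun hA' =>
  (classClause_iff_not_classClause hD jE hjfix hΘj hρρ hΘρ P₁ dg η hA hηN φ hform hΘh hh φ' hform' hΘh' hh' hκ₀ hΘκ₀ hξ hΘξ hσV₀).1 hA' hH

/-! ## §3 The A-window cut: an anisotropic-class digit lies on a sphere of index `< d` -/

/-- **AN ANISOTROPIC-CLASS DIGIT LIES ON A NEAR SPHERE (`i < d`).**  CORE frame of ★ `not_classClause'_of_far` (+ `ρ` isometric, `|jE a| = |a|`, lane B `|α − ρα| = 1`) and a chart with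
`κ₀ + ρκ₀ = 1`, `|κ₀| = 1`, `ρξ₀ = −ξ₀` (ANY `|ξ₀|`): if the digit `κ₀ + jE V₀·ξ₀` lies on the sphere of the cell `(b + 2i, b)` and is of the anisotropic class, then `i < d` — for `d ≤ i` the
sphere has `max 1 (|V₀|·|ξ₀|) = exp 2i` (★ `sphereClause_iff_max_eq`), hence `|V₀|·|ξ₀| = exp 2i ≥ exp(2d − 1)`, a FAR sphere with no A-class digit (★ `not_classClause'_of_far`).
(= the A-window cut `IA = range (min N d)` of ★ HEAD₃ ∕ ★ p864238 §2′ `hwinA`.) [cite: Serre1979, Ch. II §1; Ch. V §3 Prop. 5, Cor. 2–3 pp. 84–86] [cite: Flicker1998UnitaryFL, Prop. 7 p. 84] -/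
theorem sphereIndex_lt_of_classA [CompleteSpace E] [Finite 𝓀[E]] {σ : E →+* E} {ϖ : E} {d tE : ℕ} (hD : IsRamifiedQuadraticDatum σ ϖ d tE)
    (jE : E →+* M) (hjfix : ∀ z, ρ z = z ↔ ∃ c, jE c = z) (hΘj : ∀ c, Θ (jE c) = jE (σ c)) (hjiso : ∀ a, Valued.v (jE a) = Valued.v a)
    (hρρ : ∀ x, ρ (ρ x) = x) (hvρ : ∀ x, Valued.v (ρ x) = Valued.v x) (hΘρ : ∀ x, Θ (ρ x) = ρ (Θ x)) (hU : Valued.v (α - ρ α) = 1)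
    (P₁ : GL (Fin 3) E) (dg : Fin 2 → E) (η : E)
    (hA : formCongr σ P₁ ((StdForm.antidiagonal 3).over E) =
      (!![(Matrix.diagonal dg) 0 0, 0, (Matrix.diagonal dg) 0 1; 0, η, 0; (Matrix.diagonal dg) 1 0, 0, (Matrix.diagonal dg) 1 1] : Matrix (Fin 3) (Fin 3) E))
    (hηN : ¬ ∃ t : E, t * σ t = η)
    (φ : (Fin 2 → E) →+ M) {h : M} (hform : ∀ x y, jE (pairing σ ((StdForm.antidiagonal 2).over E) x y) = h * Θ (φ x) * φ y + ρ (h * Θ (φ x) * φ y))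
    (hΘh : Θ h = h) (hh : h ≠ 0)
    (φ' : (Fin 2 → E) →+ M) {h' : M} (hform' : ∀ x y, jE (pairing σ (Matrix.diagonal dg) x y) = h' * Θ (φ' x) * φ' y + ρ (h' * Θ (φ' x) * φ' y))
    (hΘh' : Θ h' = h') (hh' : h' ≠ 0)
    {κ₀ ξ₀ : M} (hκ₀ : κ₀ + ρ κ₀ = 1) (hΘκ₀ : Θ κ₀ = κ₀) (hκ₀1 : Valued.v κ₀ = 1) (hξ : ρ ξ₀ = -ξ₀) (hΘξ : Θ ξ₀ = ξ₀)
    {V₀ : E} (hσV₀ : σ V₀ = V₀) {b i : ℕ}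
    (hsph : Valued.v (κ₀ + jE V₀ * ξ₀) * Valued.v (jE ϖ ^ (b + 2 * i) * (α - ρ α)) = Valued.v (jE ϖ) ^ b)
    (hclA : ∃ e : M, ρ e = e ∧ e * Θ e = (κ₀ + jE V₀ * ξ₀) * ρ (κ₀ + jE V₀ * ξ₀) / (h' * ρ h')) : i < d := by
  obtain ⟨-, -, hϖ, -, -, -, -⟩ := id hD
  have hρj : ∀ c : E, ρ (jE c) = jE c := fun c => (hjfix _).2 ⟨c, rfl⟩
  by_contra hdi
  have hdi' : d ≤ i := not_lt.1 hdi
  -- on the sphere of index `i ≥ d ≥ 1`: `|V₀|·|ξ₀| = exp 2i ≥ exp(2d − 1)`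
  have hmax : max 1 (Valued.v V₀ * Valued.v ξ₀) = exp (2 * (i : ℤ)) := by
    have h1 := (sphereClause_iff_max_eq hvρ jE hρj hjiso hϖ hU hκ₀ hκ₀1 hξ V₀ (b + 2 * i) b).1 hsph
    rw [h1]; congr 1; push_cast; ring
  have hfar : exp (2 * (d : ℤ) - 1) ≤ Valued.v V₀ * Valued.v ξ₀ := by
    rcases le_total 1 (Valued.v V₀ * Valued.v ξ₀) with hle | hle
    · rw [max_eq_right hle] at hmax; rw [hmax, exp_le_exp]; omega
    · rw [max_eq_left hle] at hmax
      -- then `1 = exp 2i`, i.e. `i = 0`, contradicting `1 ≤ d ≤ i`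
      have h0 : (0 : ℤ) = 2 * (i : ℤ) := by rw [← exp_inj, exp_zero]; exact hmax
      have hd1 : 1 ≤ d := hD.2.2.2.2.2.1
      omega
  exact not_classClause'_of_far hD jE hjfix hΘj hjiso hρρ hvρ hΘρ P₁ dg η hA hηN φ hform hΘh hh φ' hform' hΘh' hh' hκ₀ hΘκ₀ hκ₀1 hξ hΘξ hσV₀ hfar hclA

/-! ## §4 HEAD-cov — the inside digit system is covered by the inside cells of the two literals -/

/-- **HEAD-cov — «THE INSIDE DIGIT SYSTEM IS COVERED BY THE INSIDE CELLS OF THE TWO LITERALS» (predicate form).**  CORE frame (as in §3) in the INSIDE chart: `κ₀ + ρκ₀ = 1`,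
`Θκ₀ = κ₀`, `|κ₀| = 1`, `ρξ₀ = −ξ₀`, `Θξ₀ = ξ₀`, `|ξ₀| = exp 2(N − 1)`, `1 ≤ N`; a `σ`-fixed INTEGRAL digit `V₀`.  THEN, with F1b ★ p864627's literal predicate
`LIT_t i V₀ :≡ SPHERE(b + 2i) ∧ CLASS_{h_t}`: **`(∃ i ∈ Finset.range N, LIT_H i V₀) ∨ (∃ i ∈ Finset.range (min N d), LIT_A i V₀)`** — the digit lies on the sphere of some cell `i ≤ N − 1`
(★ `exists_sphereClause_of_oneChart` at `N − 1`), is H-class or A-class (★ `classClause_or`), and if A-class then `i < d` (§3).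
[cite: Serre1979, Ch. II §1; Ch. V §3 Prop. 5, Cor. 2–3 pp. 84–86] [cite: Flicker1998UnitaryFL, Prop. 7 p. 84] [cite: Kottwitz1986BaseChangeUnits, §1 pp. 240–241] -/
theorem insideDigit_cover [CompleteSpace E] [Finite 𝓀[E]] {σ : E →+* E} {ϖ : E} {d tE : ℕ} (hD : IsRamifiedQuadraticDatum σ ϖ d tE)
    (jE : E →+* M) (hjfix : ∀ z, ρ z = z ↔ ∃ c, jE c = z) (hΘj : ∀ c, Θ (jE c) = jE (σ c)) (hjiso : ∀ a, Valued.v (jE a) = Valued.v a)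
    (hρρ : ∀ x, ρ (ρ x) = x) (hvρ : ∀ x, Valued.v (ρ x) = Valued.v x) (hΘρ : ∀ x, Θ (ρ x) = ρ (Θ x)) (hU : Valued.v (α - ρ α) = 1)
    (P₁ : GL (Fin 3) E) (dg : Fin 2 → E) (η : E)
    (hA : formCongr σ P₁ ((StdForm.antidiagonal 3).over E) =
      (!![(Matrix.diagonal dg) 0 0, 0, (Matrix.diagonal dg) 0 1; 0, η, 0; (Matrix.diagonal dg) 1 0, 0, (Matrix.diagonal dg) 1 1] : Matrix (Fin 3) (Fin 3) E))
    (hηN : ¬ ∃ t : E, t * σ t = η)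
    (φ : (Fin 2 → E) →+ M) {h : M} (hform : ∀ x y, jE (pairing σ ((StdForm.antidiagonal 2).over E) x y) = h * Θ (φ x) * φ y + ρ (h * Θ (φ x) * φ y))
    (hΘh : Θ h = h) (hh : h ≠ 0)
    (φ' : (Fin 2 → E) →+ M) {h' : M} (hform' : ∀ x y, jE (pairing σ (Matrix.diagonal dg) x y) = h' * Θ (φ' x) * φ' y + ρ (h' * Θ (φ' x) * φ' y))
    (hΘh' : Θ h' = h') (hh' : h' ≠ 0)
    {κ₀ ξ₀ : M} (hκ₀ : κ₀ + ρ κ₀ = 1) (hΘκ₀ : Θ κ₀ = κ₀) (hκ₀1 : Valued.v κ₀ = 1) (hξ : ρ ξ₀ = -ξ₀) (hΘξ : Θ ξ₀ = ξ₀)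
    {N : ℕ} (hN : 1 ≤ N) (hξN : Valued.v ξ₀ = exp (2 * ((N : ℤ) - 1))) (b : ℕ)
    {V₀ : E} (hσV₀ : σ V₀ = V₀) (hV₀ : Valued.v V₀ ≤ 1) :
    (∃ i ∈ Finset.range N,
        Valued.v (κ₀ + jE V₀ * ξ₀) * Valued.v (jE ϖ ^ (b + 2 * i) * (α - ρ α)) = Valued.v (jE ϖ) ^ b ∧
          ∃ e : M, ρ e = e ∧ e * Θ e = (κ₀ + jE V₀ * ξ₀) * ρ (κ₀ + jE V₀ * ξ₀) / (h * ρ h)) ∨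
      (∃ i ∈ Finset.range (min N d),
        Valued.v (κ₀ + jE V₀ * ξ₀) * Valued.v (jE ϖ ^ (b + 2 * i) * (α - ρ α)) = Valued.v (jE ϖ) ^ b ∧
          ∃ e : M, ρ e = e ∧ e * Θ e = (κ₀ + jE V₀ * ξ₀) * ρ (κ₀ + jE V₀ * ξ₀) / (h' * ρ h')) := by
  have hρj : ∀ c : E, ρ (jE c) = jE c := fun c => (hjfix _).2 ⟨c, rfl⟩
  have hξN' : Valued.v ξ₀ = exp (2 * ((N - 1 : ℕ) : ℤ)) := by rw [hξN]; congr 1; omega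
  obtain ⟨i, hiN, hsph⟩ := exists_sphereClause_of_oneChart hvρ hD jE hρj hjiso hU hκ₀ hκ₀1 hξ hξN' hσV₀ hV₀ b
  rcases classClause_or hD jE hjfix hΘj hρρ hΘρ P₁ dg η hA hηN φ hform hΘh hh φ' hform' hΘh' hh' hκ₀ hΘκ₀ hξ hΘξ hσV₀ with hH | hA'
  · exact Or.inl ⟨i, Finset.mem_range.2 (by omega), hsph, hH⟩
  · have hid : i < d := sphereIndex_lt_of_classA hD jE hjfix hΘj hjiso hρρ hvρ hΘρ hU P₁ dg η hA hηN φ hform hΘh hh φ' hform' hΘh' hh' hκ₀ hΘκ₀ hκ₀1 hξ hΘξ hσV₀ hsph hA'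
    exact Or.inr ⟨i, Finset.mem_range.2 (lt_min (by omega) hid), hsph, hA'⟩

/-- **HEAD-cov, FINSET FORM (K6 DESK WORD #16 (P2) bytes).**  Frame of `insideDigit_cover` and a digit system `Rd : Finset E` of `σ`-fixed (`hRdσ`) integral (`hRd1`) elements.  THEN for
every `V ∈ Rd`: **`(∃ i ∈ Finset.range N, V ∈ Rd.filter (LIT_H i)) ∨ (∃ i ∈ Finset.range (min N d), V ∈ Rd.filter (LIT_A i))`** with `LIT_t i` F1b ★ p864627's `Rd.filter` lambda at
`j := b + 2i` — ★ HEAD₃'s `hcov` for `S′_t i := Rd.filter (LIT_t i)` (refine by a label `NX` on the consumer's side with `B := Rd.filter NX`).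
[cite: Serre1979, Ch. II §1; Ch. V §3 Prop. 5, Cor. 2–3 pp. 84–86] [cite: Flicker1998UnitaryFL, Prop. 7 p. 84] [cite: Kottwitz1986BaseChangeUnits, §1 pp. 240–241] -/
theorem insideDigit_cover_filter [CompleteSpace E] [Finite 𝓀[E]] {σ : E →+* E} {ϖ : E} {d tE : ℕ} (hD : IsRamifiedQuadraticDatum σ ϖ d tE)
    (jE : E →+* M) (hjfix : ∀ z, ρ z = z ↔ ∃ c, jE c = z) (hΘj : ∀ c, Θ (jE c) = jE (σ c)) (hjiso : ∀ a, Valued.v (jE a) = Valued.v a)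
    (hρρ : ∀ x, ρ (ρ x) = x) (hvρ : ∀ x, Valued.v (ρ x) = Valued.v x) (hΘρ : ∀ x, Θ (ρ x) = ρ (Θ x)) (hU : Valued.v (α - ρ α) = 1)
    (P₁ : GL (Fin 3) E) (dg : Fin 2 → E) (η : E)
    (hA : formCongr σ P₁ ((StdForm.antidiagonal 3).over E) =
      (!![(Matrix.diagonal dg) 0 0, 0, (Matrix.diagonal dg) 0 1; 0, η, 0; (Matrix.diagonal dg) 1 0, 0, (Matrix.diagonal dg) 1 1] : Matrix (Fin 3) (Fin 3) E))
    (hηN : ¬ ∃ t : E, t * σ t = η)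
    (φ : (Fin 2 → E) →+ M) {h : M} (hform : ∀ x y, jE (pairing σ ((StdForm.antidiagonal 2).over E) x y) = h * Θ (φ x) * φ y + ρ (h * Θ (φ x) * φ y))
    (hΘh : Θ h = h) (hh : h ≠ 0)
    (φ' : (Fin 2 → E) →+ M) {h' : M} (hform' : ∀ x y, jE (pairing σ (Matrix.diagonal dg) x y) = h' * Θ (φ' x) * φ' y + ρ (h' * Θ (φ' x) * φ' y))
    (hΘh' : Θ h' = h') (hh' : h' ≠ 0)
    {κ₀ ξ₀ : M} (hκ₀ : κ₀ + ρ κ₀ = 1) (hΘκ₀ : Θ κ₀ = κ₀) (hκ₀1 : Valued.v κ₀ = 1) (hξ : ρ ξ₀ = -ξ₀) (hΘξ : Θ ξ₀ = ξ₀)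
    {N : ℕ} (hN : 1 ≤ N) (hξN : Valued.v ξ₀ = exp (2 * ((N : ℤ) - 1))) (b : ℕ)
    (Rd : Finset E) (hRdσ : ∀ V ∈ Rd, σ V = V) (hRd1 : ∀ V ∈ Rd, Valued.v V ≤ 1) :
    ∀ V ∈ Rd,
      (∃ i ∈ Finset.range N, V ∈ Rd.filter (fun V₀ : E => Valued.v (κ₀ + jE V₀ * ξ₀) * Valued.v (jE ϖ ^ (b + 2 * i) * (α - ρ α)) = Valued.v (jE ϖ) ^ b ∧
        ∃ e : M, ρ e = e ∧ e * Θ e = (κ₀ + jE V₀ * ξ₀) * ρ (κ₀ + jE V₀ * ξ₀) / (h * ρ h))) ∨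
      (∃ i ∈ Finset.range (min N d), V ∈ Rd.filter (fun V₀ : E => Valued.v (κ₀ + jE V₀ * ξ₀) * Valued.v (jE ϖ ^ (b + 2 * i) * (α - ρ α)) = Valued.v (jE ϖ) ^ b ∧
        ∃ e : M, ρ e = e ∧ e * Θ e = (κ₀ + jE V₀ * ξ₀) * ρ (κ₀ + jE V₀ * ξ₀) / (h' * ρ h'))) := by
  intro V hV
  rcases insideDigit_cover hD jE hjfix hΘj hjiso hρρ hvρ hΘρ hU P₁ dg η hA hηN φ hform hΘh hh φ' hform' hΘh' hh' hκ₀ hΘκ₀ hκ₀1 hξ hΘξ hN hξN b (hRdσ V hV) (hRd1 V hV)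
    with ⟨i, hi, hlit⟩ | ⟨i, hi, hlit⟩
  · exact Or.inl ⟨i, hi, Finset.mem_filter.2 ⟨hV, hlit⟩⟩
  · exact Or.inr ⟨i, hi, Finset.mem_filter.2 ⟨hV, hlit⟩⟩

omit [Valued E ℤᵐ⁰] in
/-- **HEAD-sph IN THE DIGIT CURRENCY (★ HEAD₃'s `hSPH` bytes)**: for every `V ∈ Rd` and all `i i′`, `SPH i V → SPH i′ V → i = i′` with
`SPH i V := Valued.v (κ₀ + jE V·ξ₀) · Valued.v (jE ϖ^(b+2i)·(α − ρα)) = Valued.v (jE ϖ)^b`. [cite: Serre1979, Ch. II §1] -/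
theorem insideDigit_sphereIndex_unique [Valued E ℤᵐ⁰] (jE : E →+* M) (hjiso : ∀ a, Valued.v (jE a) = Valued.v a) {ϖ : E} (hϖ : Valued.v ϖ = exp (-1 : ℤ))
    (hU : Valued.v (α - ρ α) = 1) (κ₀ ξ₀ : M) (b : ℕ) (Rd : Finset E) :
    ∀ V ∈ Rd, ∀ i i' : ℕ,
      Valued.v (κ₀ + jE V * ξ₀) * Valued.v (jE ϖ ^ (b + 2 * i) * (α - ρ α)) = Valued.v (jE ϖ) ^ b →
        Valued.v (κ₀ + jE V * ξ₀) * Valued.v (jE ϖ ^ (b + 2 * i') * (α - ρ α)) = Valued.v (jE ϖ) ^ b → i = i' :=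
  fun _ _ _ _ hi hi' => sphereIndex_unique (ρ := ρ) jE hjiso hϖ hU hi hi'

omit [Valued M ℤᵐ⁰] in
/-- **HEAD-cls IN THE DIGIT CURRENCY (★ HEAD₃'s `hHA` bytes)**: CORE frame of §2 and a `σ`-fixed digit system `Rd`: for every `V ∈ Rd`, `CLASS_h V → ¬ CLASS_{h′} V`.
[cite: Jacobowitz1962, §3] [cite: Serre1979, Ch. V §3 Prop. 5, Cor. 2–3 pp. 84–86] -/
theorem insideDigit_classH_not_classA [CompleteSpace E] [Finite 𝓀[E]] {σ : E →+* E} {ϖ : E} {d tE : ℕ} (hD : IsRamifiedQuadraticDatum σ ϖ d tE)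
    (jE : E →+* M) (hjfix : ∀ z, ρ z = z ↔ ∃ c, jE c = z) (hΘj : ∀ c, Θ (jE c) = jE (σ c))
    (hρρ : ∀ x, ρ (ρ x) = x) (hΘρ : ∀ x, Θ (ρ x) = ρ (Θ x)) (P₁ : GL (Fin 3) E) (dg : Fin 2 → E) (η : E)
    (hA : formCongr σ P₁ ((StdForm.antidiagonal 3).over E) =
      (!![(Matrix.diagonal dg) 0 0, 0, (Matrix.diagonal dg) 0 1; 0, η, 0; (Matrix.diagonal dg) 1 0, 0, (Matrix.diagonal dg) 1 1] : Matrix (Fin 3) (Fin 3) E))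
    (hηN : ¬ ∃ t : E, t * σ t = η)
    (φ : (Fin 2 → E) →+ M) {h : M} (hform : ∀ x y, jE (pairing σ ((StdForm.antidiagonal 2).over E) x y) = h * Θ (φ x) * φ y + ρ (h * Θ (φ x) * φ y))
    (hΘh : Θ h = h) (hh : h ≠ 0)
    (φ' : (Fin 2 → E) →+ M) {h' : M} (hform' : ∀ x y, jE (pairing σ (Matrix.diagonal dg) x y) = h' * Θ (φ' x) * φ' y + ρ (h' * Θ (φ' x) * φ' y))
    (hΘh' : Θ h' = h') (hh' : h' ≠ 0)
    {κ₀ ξ₀ : M} (hκ₀ : κ₀ + ρ κ₀ = 1) (hΘκ₀ : Θ κ₀ = κ₀) (hξ : ρ ξ₀ = -ξ₀) (hΘξ : Θ ξ₀ = ξ₀)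
    (Rd : Finset E) (hRdσ : ∀ V ∈ Rd, σ V = V) :
    ∀ V ∈ Rd, (∃ e : M, ρ e = e ∧ e * Θ e = (κ₀ + jE V * ξ₀) * ρ (κ₀ + jE V * ξ₀) / (h * ρ h)) →
      ¬ ∃ e : M, ρ e = e ∧ e * Θ e = (κ₀ + jE V * ξ₀) * ρ (κ₀ + jE V * ξ₀) / (h' * ρ h') :=
  fun V hV hH => classH_not_classA hD jE hjfix hΘj hρρ hΘρ P₁ dg η hA hηN φ hform hΘh hh φ' hform' hΘh' hh' hκ₀ hΘκ₀ hξ hΘξ (hRdσ V hV) hH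

end Summit.HodgeConjecture.HodgeConjecture.Cruxes.H413.F0P3cDyRamInsideDigitCover

end
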